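import Summits.HodgeConjecture.HodgeConjecture.Theorems.CYFormCasimirCYFormCarrierEightLagrangianPrep
import HarnessLib

/-!
# Crux X1 `CYFormCarrierEight` (route `CYFormCasimir`, stmt-HodgeConjecture-23493), helper file 20:
# the LAGRANGIAN FRAME of a hyperbolic Weil eightfold — a Weil frame whose first monomial `w_{I₀}` spans `⋀⁴U₊` and whose
# dual monomial `w^*_{I₀ᶜ}` spans `⋀⁴U₋`, for the `K`-stable Lagrangian `U` of `IsHyperbolicWeilType`

research route conditional on HC_CM; not a corollary. Nothing here proves HC, HC_CM, the rung H2, X1 or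
`stub_cyform_exists`; step S4 of `Cruxes/CYFormCarrierEight/STUB-PLAN-stub_cyform_exists.md` — the hyperbolicity input.

`IsHyperbolicWeilType A φ 4 h_K` gives rational, `φ^*`-stable, `Q_{h_K}`-isotropic, independent `u₁, …, u₈ ∈ H¹(A(ℂ); ℂ)`
spanning `𝒰 = U ⊗ ℂ`. With the `K`-rational eigen-projectors `p± = (2i√d)⁻¹(±φ^* + i√d)` (helper file 19):
`U₊ = p₊ 𝒰 = 𝒰 ∩ W`, `U₋ = p₋ 𝒰 = 𝒰 ∩ W^*`, `𝒰 = U₊ ⊕ U₋`, and a coefficient twist `σ_*` with `σ(i√d) = -i√d` exchanges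
them, so `dim U₊ = dim U₋ = 4`. **`exists_lagrangian_frame`**: there are a basis `w` of `W` and a class `u₋ = δ · w^*_{I₀ᶜ}`
(`δ ≠ 0`, `I₀ = {0,1,2,3}`) such that, with `u₊ := w_{I₀} = p₊u_{i₁} ∪ ⋯ ∪ p₊u_{i₄}` and `u₋ = p₋u_{i₁} ∪ ⋯ ∪ p₋u_{i₄}`,
every `σ_*` with `σ(i√d) = i√d` FIXES `u₊` and `u₋`, and every `σ_*` with `σ(i√d) = -i√d` EXCHANGES them. The point
`u₋ ∈ ℂ · w^*_{I₀ᶜ}` is the Lagrangian input: `U₋` is `Q`-orthogonal to `U₊ = ⟨w₀,…,w₃⟩`, hence spanned by the dual vectors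
`w^*₄,…,w^*₇` ("`⋆(⋀ⁿ U₊) = ⋀ⁿ U₋`" for a Lagrangian `U`).

References: vanGeemen1994HodgeAV (Lemma 5.2 (2)–(3), 5.4, proof of Thm. 6.12), FriedmanLaza2013 (§3.5 Lemma 36),
Deligne1982HodgeCycles (I §3).
-/

-- `Summit.HodgeConjecture.HodgeConjecture.…` is the tree's mandated summit/problem namespace (single-problem summit).
set_option linter.dupNamespace false
noncomputable section

open CategoryTheory
open Literature.AlgebraicTopology.SingularHomology
open Literature.AlgebraicGeometry.Motives
open Literature.AlgebraicGeometry.HodgeTheory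
open Literature.AlgebraicGeometry.VanGeemen1994

namespace Summit.HodgeConjecture.HodgeConjecture.Theorems.CYFormCarrier

section LagrangianFrame

variable {A : AbelianVariety ℂ} {d : ℕ} {φ : A ⟶ A}
variable (hd : 0 < d) (hA : A.dim = 2 * 4) (hφ : φ ≫ φ = -(d • 𝟙 A))
  (e : ProjectiveEmbedding A.X) {a : complexBetti (projectiveSpace e.n ℂ) 2} (ha : IsRationalClass a) (ha0 : a ≠ 0)

include hd hA hφ in
/-- **The Lagrangian frame.** For a hyperbolic `(A, φ, h_K)` there are a basis `w` of `W`, a class `u₋ ∈ H⁴(A(ℂ); ℂ)` and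
`δ ≠ 0` with `u₋ = δ · w^*_{I₀ᶜ}` (`I₀ = {0,1,2,3}`), such that every coefficient twist `σ_*` fixes `u₊ := w_{I₀}` and `u₋` when
`σ(i√d) = i√d` and exchanges them when `σ(i√d) = -i√d`. (Here `w₀,…,w₃ = p₊u_{i₁},…,p₊u_{i₄}` is a `K`-rational basis of
`U₊ = (U ⊗ ℂ) ∩ W` for the `K`-stable Lagrangian `U` of `IsHyperbolicWeilType`, `u₋ = p₋u_{i₁} ∪ ⋯ ∪ p₋u_{i₄}`, and
`U₋ = (U ⊗ ℂ) ∩ W^* ⊥_Q U₊` lies in the span of `w^*₄,…,w^*₇`.) [cite: vanGeemen1994HodgeAV, Lemma 5.2 (2)–(3) and 5.4]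
[cite: FriedmanLaza2013, §3.5 Lemma 36] -/
theorem exists_lagrangian_frame (hhyp : IsHyperbolicWeilType A φ 4 (hK d φ e a))
    (hqk : 2 * 2 + 2 * 2 = Fintype.card (Fin (2 * 4))) :
    ∃ (w : Module.Basis (Fin (2 * 4)) ℂ (eigW A φ d)) (uM : complexBetti A.X (2 * 2)) (δ : ℂ), δ ≠ 0 ∧
      uM = δ • monB (weilBasis (m := 2 * 4 - 1) (k := 2 * 4) (by omega) (by omega) hd hφ e ha ha0 w) (2 * 2)
        (Set.powersetCard.map (2 * 2) (Fin.natAddEmb (2 * 4))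
          (Set.powersetCard.compl hqk (Set.powersetCard.ofCard card_map_castAddEmb_univ_four))) ∧
      (∀ σ : ℂ ≃+* ℂ, σ (Complex.I * (Real.sqrt d : ℂ)) = Complex.I * (Real.sqrt d : ℂ) →
        coeffClass (R := ℂ) (S := ℂ) σ.toRingHom.toAddMonoidHom (2 * 2)
            (monB (weilBasis (m := 2 * 4 - 1) (k := 2 * 4) (by omega) (by omega) hd hφ e ha ha0 w) (2 * 2)
              (Set.powersetCard.map (2 * 2) (Fin.castAddEmb (2 * 4)) (Set.powersetCard.ofCard card_map_castAddEmb_univ_four))) =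
          monB (weilBasis (m := 2 * 4 - 1) (k := 2 * 4) (by omega) (by omega) hd hφ e ha ha0 w) (2 * 2)
            (Set.powersetCard.map (2 * 2) (Fin.castAddEmb (2 * 4)) (Set.powersetCard.ofCard card_map_castAddEmb_univ_four)) ∧
        coeffClass (R := ℂ) (S := ℂ) σ.toRingHom.toAddMonoidHom (2 * 2) uM = uM) ∧
      (∀ σ : ℂ ≃+* ℂ, σ (Complex.I * (Real.sqrt d : ℂ)) = -(Complex.I * (Real.sqrt d : ℂ)) →
        coeffClass (R := ℂ) (S := ℂ) σ.toRingHom.toAddMonoidHom (2 * 2)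
            (monB (weilBasis (m := 2 * 4 - 1) (k := 2 * 4) (by omega) (by omega) hd hφ e ha ha0 w) (2 * 2)
              (Set.powersetCard.map (2 * 2) (Fin.castAddEmb (2 * 4)) (Set.powersetCard.ofCard card_map_castAddEmb_univ_four))) = uM ∧
        coeffClass (R := ℂ) (S := ℂ) σ.toRingHom.toAddMonoidHom (2 * 2) uM =
          monB (weilBasis (m := 2 * 4 - 1) (k := 2 * 4) (by omega) (by omega) hd hφ e ha ha0 w) (2 * 2)
            (Set.powersetCard.map (2 * 2) (Fin.castAddEmb (2 * 4)) (Set.powersetCard.ofCard card_map_castAddEmb_univ_four))) := by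
  classical
  haveI := finite_complexBetti_abelianVariety A 1
  set s : ℂ := Complex.I * (Real.sqrt d : ℂ) with hs
  -- the Lagrangian datum
  obtain ⟨u, hur, huli, hust, huiso⟩ := hhyp
  set T := pullbackOne A φ with hT
  set pP : complexBetti A.X 1 → complexBetti A.X 1 := fun c ↦ (2 * s)⁻¹ • (T c + s • c) with hpP
  set pM : complexBetti A.X 1 → complexBetti A.X 1 := fun c ↦ (2 * s)⁻¹ • (s • c - T c) with hpM
  set UU := Submodule.span ℂ (Set.range u) with hUU
  set UP := Submodule.span ℂ (Set.range fun i ↦ pP (u i)) with hUP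
  set UM := Submodule.span ℂ (Set.range fun i ↦ pM (u i)) with hUM
  have hT_mem : ∀ x ∈ UU, T x ∈ UU := fun x hx ↦ map_mem_span_of_forall_map_mem hust hx
  -- `p±` are linear
  have hpP_add : ∀ x y, pP (x + y) = pP x + pP y := fun x y ↦ by
    simp only [hpP, map_add, smul_add]; abel
  have hpP_smul : ∀ (c : ℂ) x, pP (c • x) = c • pP x := fun c x ↦ by
    simp only [hpP, map_smul, smul_add, smul_comm c]
  have hpM_add : ∀ x y, pM (x + y) = pM x + pM y := fun x y ↦ by
    simp only [hpM, map_add, smul_add, smul_sub]; abel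
  have hpM_smul : ∀ (c : ℂ) x, pM (c • x) = c • pM x := fun c x ↦ by
    simp only [hpM, map_smul, smul_sub, smul_comm c]
  -- basic inclusions
  have hUP_W : UP ≤ eigW A φ d := Submodule.span_le.2 (by rintro _ ⟨i, rfl⟩; exact projPlus_mem_eigW hφ (u i))
  have hUM_W : UM ≤ eigWbar A φ d := Submodule.span_le.2 (by rintro _ ⟨i, rfl⟩; exact projMinus_mem_eigWbar hφ (u i))
  have hu_mem : ∀ i, u i ∈ UU := fun i ↦ Submodule.subset_span ⟨i, rfl⟩
  have hpP_mem : ∀ x ∈ UU, pP x ∈ UU := fun x hx ↦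
    Submodule.smul_mem _ _ (Submodule.add_mem _ (hT_mem x hx) (Submodule.smul_mem _ _ hx))
  have hpM_mem : ∀ x ∈ UU, pM x ∈ UU := fun x hx ↦
    Submodule.smul_mem _ _ (Submodule.sub_mem _ (Submodule.smul_mem _ _ hx) (hT_mem x hx))
  have hUP_U : UP ≤ UU := Submodule.span_le.2 (by rintro _ ⟨i, rfl⟩; exact hpP_mem _ (hu_mem i))
  have hUM_U : UM ≤ UU := Submodule.span_le.2 (by rintro _ ⟨i, rfl⟩; exact hpM_mem _ (hu_mem i))
  have hU_le : UU ≤ UP ⊔ UM := by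
    rw [hUU, Submodule.span_le]
    rintro _ ⟨i, rfl⟩
    have e1 : u i = pP (u i) + pM (u i) := (projPlus_add_projMinus (φ := φ) hd (u i)).symm
    rw [SetLike.mem_coe, e1]
    exact Submodule.add_mem _ (Submodule.mem_sup_left (Submodule.subset_span ⟨i, rfl⟩))
      (Submodule.mem_sup_right (Submodule.subset_span ⟨i, rfl⟩))
  have hsup : UP ⊔ UM = UU := le_antisymm (sup_le hUP_U hUM_U) hU_le
  have hinf : UP ⊓ UM = ⊥ := by
    rw [eq_bot_iff]
    intro x hx
    have h := (isCompl_eigenspace_eigenspace_neg hd hφ).inf_eq_bot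
    rw [Submodule.mem_bot, ← Submodule.mem_bot ℂ, ← h]
    exact ⟨hUP_W hx.1, hUM_W hx.2⟩
  -- dimensions
  have hdimU : Module.finrank ℂ UU = 8 := by rw [hUU, finrank_span_eq_card huli, Fintype.card_fin]
  have hdim_sum : Module.finrank ℂ UP + Module.finrank ℂ UM = 8 := by
    have h := Submodule.finrank_sup_add_finrank_inf_eq UP UM
    rw [hsup, hinf, finrank_bot, add_zero, hdimU] at h
    exact h.symm
  -- a conjugation-type automorphism exchanges `UP` and `UM`
  obtain ⟨κ, hκ⟩ := exists_ringEquiv_apply_I_mul_sqrt_eq_neg d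
  have hτP : ∀ σ : ℂ ≃+* ℂ, σ s = -s → ∀ x ∈ UP, coeffClass (R := ℂ) (S := ℂ) σ.toRingHom.toAddMonoidHom 1 x ∈ UM := by
    intro σ hσ x hx
    induction hx using Submodule.span_induction with
    | mem x hx =>
      obtain ⟨i, rfl⟩ := hx
      change coeffClass (R := ℂ) (S := ℂ) σ.toRingHom.toAddMonoidHom 1 ((2 * s)⁻¹ • (T (u i) + s • u i)) ∈ UM
      rw [coeffClass_projPlus_of_swap σ hσ (hur i)]
      exact Submodule.subset_span ⟨i, rfl⟩
    | zero => rw [map_zero]; exact Submodule.zero_mem _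
    | add x y _ _ hx hy => rw [map_add]; exact Submodule.add_mem _ hx hy
    | smul c x _ hx => rw [coeffClass_ringHom_smul]; exact Submodule.smul_mem _ _ hx
  have hτM : ∀ σ : ℂ ≃+* ℂ, σ s = -s → ∀ x ∈ UM, coeffClass (R := ℂ) (S := ℂ) σ.toRingHom.toAddMonoidHom 1 x ∈ UP := by
    intro σ hσ x hx
    induction hx using Submodule.span_induction with
    | mem x hx =>
      obtain ⟨i, rfl⟩ := hx
      change coeffClass (R := ℂ) (S := ℂ) σ.toRingHom.toAddMonoidHom 1 ((2 * s)⁻¹ • (s • u i - T (u i))) ∈ UP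
      rw [coeffClass_projMinus_of_swap σ hσ (hur i)]
      exact Submodule.subset_span ⟨i, rfl⟩
    | zero => rw [map_zero]; exact Submodule.zero_mem _
    | add x y _ _ hx hy => rw [map_add]; exact Submodule.add_mem _ hx hy
    | smul c x _ hx => rw [coeffClass_ringHom_smul]; exact Submodule.smul_mem _ _ hx
  have hdimP : Module.finrank ℂ UP = 4 := by
    have h1 := finrank_le_of_coeffClass_mapsTo κ UP UM (hτP κ hκ)
    have h2 := finrank_le_of_coeffClass_mapsTo κ UM UP (hτM κ hκ)
    omega
  -- four independent `K`-rational vectors spanning `UP`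
  obtain ⟨t, ht_sub, ht_span, ht_li⟩ := exists_linearIndependent ℂ (Set.range fun i ↦ pP (u i))
  have ht_fin : t.Finite := (Set.finite_range _).subset ht_sub
  haveI : Fintype t := ht_fin.fintype
  have hcard : Fintype.card t = 4 := by
    have h := finrank_span_eq_card ht_li
    rw [Subtype.range_coe_subtype, Set.setOf_mem_eq, ht_span] at h
    rw [← h]; exact hdimP
  set ev : t ≃ Fin 4 := Fintype.equivFinOfCardEq hcard with hev
  set y : Fin 4 → complexBetti A.X 1 := fun k ↦ ((ev.symm k : t) : complexBetti A.X 1) with hy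
  have hy_li : LinearIndependent ℂ y := ht_li.comp ev.symm ev.symm.injective
  have hy_mem : ∀ k, ∃ i, pP (u i) = y k := fun k ↦ by
    obtain ⟨i, hi⟩ := ht_sub (ev.symm k).2
    exact ⟨i, hi⟩
  choose idx hidx using hy_mem
  have hyP : ∀ k, y k ∈ UP := fun k ↦ by rw [← hidx k]; exact Submodule.subset_span ⟨idx k, rfl⟩
  have hyW : ∀ k, y k ∈ eigW A φ d := fun k ↦ hUP_W (hyP k)
  set yb : Fin 4 → complexBetti A.X 1 := fun k ↦ pM (u (idx k)) with hyb
  have hybM : ∀ k, yb k ∈ UM := fun k ↦ Submodule.subset_span ⟨idx k, rfl⟩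
  -- the frame
  obtain ⟨w, hw⟩ := exists_weilFrame_extending hd hA hφ y hyW hy_li
  set b := weilBasis (m := 2 * 4 - 1) (k := 2 * 4) (by omega) (by omega) hd hφ e ha ha0 w with hbdef
  have hb : b = weilBasis (m := 2 * 4 - 1) (k := 2 * 4) (by omega) (by omega) hd hφ e ha ha0 w := rfl
  set I₀ : Set.powersetCard (Fin (2 * 4)) (2 * 2) := Set.powersetCard.ofCard card_map_castAddEmb_univ_four with hI₀
  set uP := monB b (2 * 2) (Set.powersetCard.map (2 * 2) (Fin.castAddEmb (2 * 4)) I₀) with huP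
  set m₀ := monB b (2 * 2) (Set.powersetCard.map (2 * 2) (Fin.natAddEmb (2 * 4)) (Set.powersetCard.compl hqk I₀)) with hm₀
  set uM := cupPowOne ℂ (ComplexPoints A.X) (2 * 2) (fun r : Fin (2 * 2) ↦ yb r) with huM
  have huP_eq : uP = cupPowOne ℂ (ComplexPoints A.X) (2 * 2) (fun r : Fin (2 * 2) ↦ y r) := by
    rw [huP, monB_weilBasis_firstQuad hd hA hφ e ha ha0 w b hb]
    congr 1
    funext r
    exact hw r
  -- Galois behaviour of `uP`, `uM`
  have hfixP : ∀ σ : ℂ ≃+* ℂ, σ s = s → coeffClass (R := ℂ) (S := ℂ) σ.toRingHom.toAddMonoidHom (2 * 2) uP = uP := by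
    intro σ hσ
    rw [huP_eq, coeffClass_cupPowOne]
    congr 1; funext r
    rw [← hidx r]
    exact coeffClass_projPlus_of_fix σ hσ (hur (idx r))
  have hfixM : ∀ σ : ℂ ≃+* ℂ, σ s = s → coeffClass (R := ℂ) (S := ℂ) σ.toRingHom.toAddMonoidHom (2 * 2) uM = uM := by
    intro σ hσ
    rw [huM, coeffClass_cupPowOne]
    congr 1; funext r
    exact coeffClass_projMinus_of_fix σ hσ (hur (idx r))
  have hswapP : ∀ σ : ℂ ≃+* ℂ, σ s = -s → coeffClass (R := ℂ) (S := ℂ) σ.toRingHom.toAddMonoidHom (2 * 2) uP = uM := by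
    intro σ hσ
    rw [huP_eq, coeffClass_cupPowOne, huM]
    congr 1; funext r
    rw [← hidx r]
    exact coeffClass_projPlus_of_swap σ hσ (hur (idx r))
  have hswapM : ∀ σ : ℂ ≃+* ℂ, σ s = -s → coeffClass (R := ℂ) (S := ℂ) σ.toRingHom.toAddMonoidHom (2 * 2) uM = uP := by
    intro σ hσ
    rw [huM, coeffClass_cupPowOne, huP_eq]
    congr 1; funext r
    rw [← hidx r]
    exact coeffClass_projMinus_of_swap σ hσ (hur (idx r))
  -- KEY (Lagrangian): `U₋ ⊆ ⟨w^*₄, …, w^*₇⟩`, hence `uM = δ • w^*_{I₀ᶜ}`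
  set wstar := dualBasisWbar (m := 2 * 4 - 1) (by omega) (by omega) hd hφ e ha ha0 w with hwstar
  have hQiso : ∀ x ∈ UU, ∀ z ∈ UU, polarizationPairingOne A.X (hK d φ e a) (2 * 4 - 1) x z = 0 :=
    fun x hx z hz ↦ polarizationPairingOne_eq_zero_of_mem_span huiso hx hz
  have hspanM : ∀ k, yb k ∈ Submodule.span ℂ (Set.range fun r : Fin (2 * 2) ↦ b (Fin.natAdd (2 * 4) (Fin.natAdd 4 r))) := by
    intro k
    set z := yb k with hz
    have hzW : z ∈ eigWbar A φ d := hUM_W (hybM k)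
    have hzU : z ∈ UU := hUM_U (hybM k)
    -- expansion in the dual basis
    have hexp : z = ∑ j, wstar.repr ⟨z, hzW⟩ j • (wstar j : complexBetti A.X 1) := by
      have h := congrArg Subtype.val (wstar.sum_repr ⟨z, hzW⟩)
      rw [Submodule.coe_sum] at h
      simp only [Submodule.coe_smul] at h
      exact h.symm
    -- the coefficients along `w^*_j`, `j = castAdd k'`, vanish
    have hcoef : ∀ j, topCoord (dim_eq_seven_add_one hA)
        (polarizationPairingOne A.X (hK d φ e a) (2 * 4 - 1) (w j : complexBetti A.X 1) z) = wstar.repr ⟨z, hzW⟩ j := by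
      intro j
      conv_lhs => rw [hexp]
      rw [map_sum, map_sum]
      simp_rw [map_smul, smul_eq_mul]
      rw [Finset.sum_eq_single j]
      · rw [hwstar, topCoord_polarizationPairingOne_dualBasisWbar, if_pos rfl, mul_one]
      · intro j' _ hj'
        rw [hwstar, topCoord_polarizationPairingOne_dualBasisWbar, if_neg (Ne.symm hj'), mul_zero]
      · intro h; exact absurd (Finset.mem_univ j) h
    have hzero : ∀ k' : Fin 4, wstar.repr ⟨z, hzW⟩ (Fin.castAdd 4 k') = 0 := by
      intro k'
      rw [← hcoef, hw k', hQiso _ (hUP_U (hyP k')) _ hzU, map_zero]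
    rw [hexp]
    refine Submodule.sum_mem _ fun j _ ↦ ?_
    by_cases hj : (j : ℕ) < 4
    · -- first block: the coefficient vanishes
      have hj' : j = Fin.castAdd 4 (⟨j, hj⟩ : Fin 4) := Fin.ext rfl
      rw [hj', hzero, zero_smul]
      exact Submodule.zero_mem _
    · -- second block: a dual vector of the last quadruple
      set r : Fin 4 := ⟨(j : ℕ) - 4, by omega⟩ with hr
      have hj' : j = Fin.natAdd 4 r := Fin.ext (by rw [Fin.val_natAdd]; change (j : ℕ) = 4 + ((j : ℕ) - 4); omega)
      refine Submodule.smul_mem _ _ (Submodule.subset_span ⟨r, ?_⟩)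
      change b (Fin.natAdd (2 * 4) (Fin.natAdd 4 r)) = (wstar j : complexBetti A.X 1)
      rw [hb, weilBasis_natAdd, ← hj']
  obtain ⟨δ, hδ⟩ := exists_smul_cupPowOne_of_mem_span (fun r : Fin (2 * 2) ↦ b (Fin.natAdd (2 * 4) (Fin.natAdd 4 r)))
    (fun r : Fin (2 * 2) ↦ yb r) hspanM
  have hm₀_eq : m₀ = cupPowOne ℂ (ComplexPoints A.X) (2 * 2) (fun r : Fin (2 * 2) ↦ b (Fin.natAdd (2 * 4) (Fin.natAdd 4 r))) := by
    rw [hm₀, compl_firstQuad hqk]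
    exact monB_weilBasis_lastQuadDual b
  have huM_eq : uM = δ • m₀ := by rw [huM, hδ, hm₀_eq]
  -- `δ ≠ 0`: `uM = κ_* uP ≠ 0`
  have hδ0 : δ ≠ 0 := by
    intro h0
    have h1 : uM = 0 := by rw [huM_eq, h0, zero_smul]
    have h2 : coeffClass (R := ℂ) (S := ℂ) κ.toRingHom.toAddMonoidHom (2 * 2) uP = 0 := by rw [hswapP κ hκ, h1]
    have h3 : uP = 0 := coeffClass_ringEquiv_injective κ (2 * 2) (by rw [h2, map_zero])
    exact (monB b (2 * 2)).ne_zero _ h3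
  exact ⟨w, uM, δ, hδ0, huM_eq, fun σ hσ ↦ ⟨hfixP σ hσ, hfixM σ hσ⟩, fun σ hσ ↦ ⟨hswapP σ hσ, hswapM σ hσ⟩⟩

end LagrangianFrame

end Summit.HodgeConjecture.HodgeConjecture.Theorems.CYFormCarrier

end
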